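import Mathlib
import HarnessLib
import Literature.Analysis.PDE.RellichSphericalMoments
import Summits.Ventures.LatticeQCDFlow.Exactness.SphereGradientFlowPullback
import Summits.Ventures.LatticeQCDFlow.Exactness.SphereLuscherNormalization

/-!
# The transport identity for the sphere gradient flow: `(d/ds)∫e^{−sS}(H∘Φ_{c−s})dπ̄ = ∫e^{−sS}(H∘Φ_{c−s})(𝓛_sG − S)dπ̄` — the law transported by `Φ` departs from the tilted family `e^{−sS}π̄` exactly through the residual of Lüscher's flow equation

HONEST FRAMING: exact (Metropolis-corrected) sampling algorithms for lattice gauge theory;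
figures of merit are autocorrelation/cost numbers at stated couplings and volumes; no
continuum-physics claim.

Venture `LatticeQCDFlow` (cell pub-lqcd), topic `Exactness`; FANOUT row 7 (`s0-cpn-null`: the
S0-D1 rung — 2D CP⁹, Lüscher's LO trivializing map inside HMC, Engel–Schaefer 2011).  NEW WORK of
the cell over the tree's `Exactness/SphereGradientFlowPullback.lean` (this leg: the pull-back
derivative `(d/ds)H(Φ_{c−s}x) = D(H∘Φ_{c−s})(x)·∂̃G(x) = Σ_n⟪∂̃_n(H∘Φ_{c−s}), ∂̃_nG⟫` and its joint
continuity), `Exactness/SphereTiltedGreen.lean` (GEN-12: Lüscher's operator `𝓛_t` and the tilted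
Green identity `∫e^{−tS}K·𝓛_tG dπ̄ = Σ_n∫e^{−tS}⟪∂̃_nK, ∂̃_nG⟫dπ̄`, `∫e^{−tS}𝓛_tG dπ̄ = 0`),
`Exactness/SphereLuscherFiniteTimeUniqueness.lean` (`0 < ∫e^{−tS}dπ̄`) and the tree's PROVED
`Literature/Analysis/PDE/RellichSphericalMoments.lean` (`Rellich.hasDerivAt_integral_of_continuous`:
differentiation under the integral sign over a compact space); nothing is cited as a fact.  Printed
counterpart, NAMED ONLY: M. Lüscher, "Trivializing maps, the Wilson flow and the HMC algorithm",
Commun. Math. Phys. 293 (2010) 899, §3 (3.4)–(3.9) and §4.2 (4.5)–(4.9): if the generator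
`S̃_t` of the flow solves `𝓛_tS̃_t = S + Ċ_t`, the flow map trivializes `e^{−tS}`; Lüscher argues
through the Jacobian `(d/dt) ln det Φ_t^* = −(∂∂S̃_t)∘Φ_t`.  HERE THE SAME CONCLUSION IS REACHED
WITHOUT JACOBIANS, by transporting the observable instead of the measure (characteristics /
duality): for the flow `Φ` of `ẋ = −∂̃G(x)` on the lattice of site spheres `Ω = S(E)^Λ`,

* §2 **THE TRANSPORT IDENTITY** (**`hasDerivAt_integral_exp_mul_comp_family`**, abstract over a
  `C¹` family of maps `Ψ_s` with the pull-back property `(d/ds)H(Ψ_s ω) = D(H∘Ψ_s)(ω)·∂̃G_s(ω)`, and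
  **`hasDerivAt_integral_exp_mul_comp_sphereGradientFlow`** for `Ψ_s = Φ_{c−s}`):
  `(d/ds) ∫ e^{−sS}·(H∘Φ_{c−s}) dπ̄ = ∫ e^{−sS}·(H∘Φ_{c−s})·(𝓛_sG − S) dπ̄`
  for every `C¹` action `S`, `C²` generator `G`, `C¹` observable `H`, all real `c`, `s` — product
  rule under `∫dπ̄`, the pull-back derivative, and the tilted Green identity with the `C¹`
  functional `H∘Φ_{c−s}` in the symmetric slot;
* the sequel `Exactness/SphereFlowTransportCovariance.lean` divides by `Z_s = ∫e^{−sS}dπ̄`: the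
  tilted mean `⟨H∘Φ_{c−s}⟩_s` moves at the rate of the COVARIANCE of the observable with the residual
  `R_s = 𝓛_sG − S`, and a residual constant on `Ω` for `s ∈ [0, c]` (Lüscher's equation
  `𝓛_sG = S + C_s`) forces `∫H(Φ_c ω)dπ̄ = ∫e^{−cS}H dπ̄/Z_c` — the flow map transports `π̄` to the
  tilted measure.

The abstract §2 is stated for a family `Ψ_s` so that the sequel on time-dependent generators
`G_s` (Lüscher's actual `S̃_t = Σ t^kS̃⁽ᵏ⁾`, whose flow needs the two-time evolution maps) can reuse
them verbatim; the autonomous instance covers every fixed truncation used as a time-independent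
generator — in particular Engel–Schaefer's LO map `G = S̃⁽⁰⁾` (sequel
`Exactness/SphereLOMapTransportDefect.lean`: residual `ċ₀ + s·Σ⟨∂̃S, ∂̃S̃⁽⁰⁾⟩`, second-order defect).

NOT CLAIMED: the Jacobian / Liouville formula for `Φ_t` (not needed here); existence of exact
solutions of `𝓛_sG = S + C_s` (for an autonomous `G` they essentially never exist beyond `s = 0` —
the criterion is the `K → ∞` shadow of the truncated statements); equality of MEASURES
`(Φ_c)_*π̄ = μ_c` beyond the weak form with `C¹` test functionals on the ambient space; time-dependent
generators (sequel); anything about autocorrelations or the rung's numbers.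
-/

noncomputable section

namespace Summit.Ventures.LatticeQCDFlow.Exactness

open Function Set Metric MeasureTheory NormedSpace InnerProductSpace
open scoped RealInnerProductSpace Topology

variable {Λ : Type*} {E : Type*} [NormedAddCommGroup E] [InnerProductSpace ℝ E]
  [FiniteDimensional ℝ E] [Fintype Λ] [DecidableEq Λ] [MeasurableSpace E] [BorelSpace E]
  [Nontrivial E]

/-! ## §1 Two calculus helpers -/

section Helpers

omit [FiniteDimensional ℝ E] [Fintype Λ] [DecidableEq Λ] [MeasurableSpace E] [BorelSpace E]
  [Nontrivial E] [NormedAddCommGroup E] [InnerProductSpace ℝ E] in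
/-- `(d/ds) e^{−sa} = −a e^{−sa}`. -/
theorem hasDerivAt_exp_neg_mul_left (a s₀ : ℝ) :
    HasDerivAt (fun s : ℝ => Real.exp (-(s * a))) (-(a * Real.exp (-(s₀ * a)))) s₀ := by
  have h : HasDerivAt (fun s : ℝ => Real.exp (-(s * a))) (Real.exp (-(s₀ * a)) * -(1 * a)) s₀ :=
    (((hasDerivAt_id' s₀).mul_const a).neg).exp
  exact h.congr_deriv (by ring)

omit [InnerProductSpace ℝ E] [FiniteDimensional ℝ E] [Fintype Λ] [DecidableEq Λ] [MeasurableSpace E]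
  [BorelSpace E] [Nontrivial E] in
/-- Every site of a sphere configuration has norm one. -/
theorem norm_sphereConfig_eq_one (ω : Λ → sphere (0 : E) 1) (n : Λ) :
    ‖(fun m => ((ω m : sphere (0 : E) 1) : E)) n‖ = 1 :=
  norm_eq_of_mem_sphere (ω n)

/-- **The tilted Green identity read from the right**: for `S, K ∈ C¹`, `G ∈ C²`, every real `t`,
`∫ e^{−tS}·(DK·∂̃G) dπ̄ = ∫ e^{−tS}·K·𝓛_tG dπ̄`, where on `Ω` `DK(ω)·∂̃G(ω) = Σ_n⟪∂̃_nK, ∂̃_nG⟫`. -/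
theorem integral_exp_mul_fderiv_apply_siteGrad {S K G : (Λ → E) → ℝ} (hS : ContDiff ℝ 1 S)
    (hK : ContDiff ℝ 1 K) (hG : ContDiff ℝ 2 G) (t : ℝ) :
    ∫ ω, Real.exp (-(t * S (fun m => ((ω : Λ → sphere (0 : E) 1) m : E)))) *
        fderiv ℝ K (fun m => (ω m : E)) (fun n => siteGrad n G (fun m => (ω m : E)))
          ∂Measure.pi (fun _ : Λ => uniformSphere (volume : Measure E)) =
      ∫ ω, Real.exp (-(t * S (fun m => ((ω : Λ → sphere (0 : E) 1) m : E)))) *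
        K (fun m => (ω m : E)) * sphereLuscherL S t G (fun m => (ω m : E))
          ∂Measure.pi (fun _ : Λ => uniformSphere (volume : Measure E)) := by
  have hGd : Differentiable ℝ G := hG.differentiable (by norm_num)
  have hKd : Differentiable ℝ K := hK.differentiable one_ne_zero
  have hpt : ∀ ω : Λ → sphere (0 : E) 1,
      fderiv ℝ K (fun m => (ω m : E)) (fun n => siteGrad n G (fun m => (ω m : E))) =
        ∑ n, ⟪siteGrad n K (fun m => (ω m : E)), siteGrad n G (fun m => (ω m : E))⟫ := fun ω =>
    fderiv_apply_siteGrad_eq_sum_inner (norm_sphereConfig_eq_one ω) (hKd _) hGd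
  simp_rw [hpt]
  rw [integral_exp_mul_mul_sphereLuscherL hS hG hK t]
  have hi : ∀ n, Integrable (fun ω : Λ → sphere (0 : E) 1 =>
      Real.exp (-(t * S (fun m => (ω m : E)))) *
        ⟪siteGrad n K (fun m => (ω m : E)), siteGrad n G (fun m => (ω m : E))⟫)
          (Measure.pi fun _ : Λ => uniformSphere (volume : Measure E)) := fun n =>
    integrable_pi_of_continuous _ ((continuous_exp_neg_mul_sphereConfig hS.continuous t).mul
      (continuous_inner_siteGrad (hG.of_le (by norm_num)) hK n n))
  rw [← integral_finsetSum _ fun n _ => hi n]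
  refine integral_congr_ae (ae_of_all _ fun ω => ?_)
  simp only [Finset.mul_sum]

end Helpers

/-! ## §2 The transport identity -/

section Transport

/-- **THE TRANSPORT IDENTITY, ABSTRACT FAMILY.**  Let `S ∈ C¹` (action), `H ∈ C¹` (observable),
`Ψ : ℝ → (Λ → E) → (Λ → E)` jointly `C¹`, and `G_s ∈ C²` a family of generators whose natural
gradients are jointly continuous on `ℝ × Ω`, with THE PULL-BACK PROPERTY on `Ω`:
`(d/ds) H(Ψ_s ω) = D(H∘Ψ_s)(ω)·∂̃G_s(ω)` (as for `Ψ_s = Φ_{s→c}`, the evolution from time `s` to a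
fixed time `c` of `ẋ = −∂̃G_s(x)`).  Then for every real `s₀`
`(d/ds)|_{s₀} ∫ e^{−sS}·(H∘Ψ_s) dπ̄ = ∫ e^{−s₀S}·(H∘Ψ_{s₀})·(𝓛_{s₀}G_{s₀} − S) dπ̄`. -/
theorem hasDerivAt_integral_exp_mul_comp_family {S H : (Λ → E) → ℝ} {Ψ : ℝ → (Λ → E) → (Λ → E)}
    {Gs : ℝ → (Λ → E) → ℝ} (hS : ContDiff ℝ 1 S) (hH : ContDiff ℝ 1 H)
    (hΨ : ContDiff ℝ 1 fun q : ℝ × (Λ → E) => Ψ q.1 q.2) (hGs : ∀ s, ContDiff ℝ 2 (Gs s))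
    (hV : ∀ n, Continuous fun p : ℝ × (Λ → sphere (0 : E) 1) =>
      siteGrad n (Gs p.1) (fun m => (p.2 m : E)))
    (hderiv : ∀ (s : ℝ) (ω : Λ → sphere (0 : E) 1),
      HasDerivAt (fun s' => H (Ψ s' (fun m => (ω m : E))))
        (fderiv ℝ (fun z => H (Ψ s z)) (fun m => (ω m : E))
          (fun n => siteGrad n (Gs s) (fun m => (ω m : E)))) s)
    (s₀ : ℝ) :
    HasDerivAt (fun s => ∫ ω, Real.exp (-(s * S (fun m => ((ω : Λ → sphere (0 : E) 1) m : E)))) *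
        H (Ψ s (fun m => (ω m : E))) ∂Measure.pi (fun _ : Λ => uniformSphere (volume : Measure E)))
      (∫ ω, Real.exp (-(s₀ * S (fun m => ((ω : Λ → sphere (0 : E) 1) m : E)))) *
          H (Ψ s₀ (fun m => (ω m : E))) *
            (sphereLuscherL S s₀ (Gs s₀) (fun m => (ω m : E)) - S (fun m => (ω m : E)))
        ∂Measure.pi (fun _ : Λ => uniformSphere (volume : Measure E))) s₀ := by
  have hK : ∀ s, ContDiff ℝ 1 (fun z => H (Ψ s z)) := fun s =>
    hH.comp (hΨ.comp (contDiff_const.prodMk contDiff_id))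
  -- joint continuity of the integrand and of its `s`-derivative on `ℝ × Ω`
  have hSc : Continuous fun ω : Λ → sphere (0 : E) 1 => S (fun m => (ω m : E)) :=
    hS.continuous.comp continuous_sphereConfig
  have hexp : Continuous fun p : ℝ × (Λ → sphere (0 : E) 1) =>
      Real.exp (-(p.1 * S (fun m => (p.2 m : E)))) :=
    Real.continuous_exp.comp ((continuous_fst.mul (hSc.comp continuous_snd)).neg)
  have hcoe : Continuous fun p : ℝ × (Λ → sphere (0 : E) 1) =>
      ((p.1, fun m => (p.2 m : E)) : ℝ × (Λ → E)) :=
    continuous_fst.prodMk (continuous_sphereConfig.comp continuous_snd)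
  have hHΨ : Continuous fun p : ℝ × (Λ → sphere (0 : E) 1) => H (Ψ p.1 (fun m => (p.2 m : E))) :=
    (hH.continuous.comp hΨ.continuous).comp hcoe
  have hD : Continuous fun p : ℝ × (Λ → sphere (0 : E) 1) =>
      fderiv ℝ (fun z => H (Ψ p.1 z)) (fun m => (p.2 m : E))
        (fun n => siteGrad n (Gs p.1) (fun m => (p.2 m : E))) := by
    have h1 : ContDiff ℝ 1 (uncurry fun (q : ℝ × (Λ → E)) (z : Λ → E) => H (Ψ q.1 z)) :=
      hH.comp (hΨ.comp ((contDiff_fst.comp contDiff_fst).prodMk contDiff_snd))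
    have h2 := (Continuous.fderiv_one h1 continuous_snd).comp hcoe
    have h3 : Continuous fun p : ℝ × (Λ → sphere (0 : E) 1) =>
        fun n => siteGrad n (Gs p.1) (fun m => (p.2 m : E)) :=
      continuous_pi fun n => hV n
    exact h2.clm_apply h3
  have hF : Continuous (uncurry fun (s : ℝ) (ω : Λ → sphere (0 : E) 1) =>
      Real.exp (-(s * S (fun m => (ω m : E)))) * H (Ψ s (fun m => (ω m : E)))) :=
    hexp.mul hHΨ
  have hF' : Continuous (uncurry fun (s : ℝ) (ω : Λ → sphere (0 : E) 1) =>
      -(S (fun m => (ω m : E)) * Real.exp (-(s * S (fun m => (ω m : E))))) *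
          H (Ψ s (fun m => (ω m : E))) +
        Real.exp (-(s * S (fun m => (ω m : E)))) *
          fderiv ℝ (fun z => H (Ψ s z)) (fun m => (ω m : E))
            (fun n => siteGrad n (Gs s) (fun m => (ω m : E)))) :=
    (((hSc.comp continuous_snd).mul hexp).neg.mul hHΨ).add (hexp.mul hD)
  have hd : ∀ (s : ℝ) (ω : Λ → sphere (0 : E) 1),
      HasDerivAt (fun s' => Real.exp (-(s' * S (fun m => (ω m : E)))) * H (Ψ s' (fun m => (ω m : E))))
        (-(S (fun m => (ω m : E)) * Real.exp (-(s * S (fun m => (ω m : E))))) *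
            H (Ψ s (fun m => (ω m : E))) +
          Real.exp (-(s * S (fun m => (ω m : E)))) *
            fderiv ℝ (fun z => H (Ψ s z)) (fun m => (ω m : E))
              (fun n => siteGrad n (Gs s) (fun m => (ω m : E)))) s := fun s ω =>
    (hasDerivAt_exp_neg_mul_left (S (fun m => (ω m : E))) s).mul (hderiv s ω)
  have hmain := Literature.Analysis.PDE.Rellich.hasDerivAt_integral_of_continuous
    (ν := Measure.pi (fun _ : Λ => uniformSphere (volume : Measure E))) hF hF' hd s₀
  refine hmain.congr_deriv ?_
  -- evaluate `∫ F'(s₀, ·) dπ̄` by the tilted Green identity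
  have hcW := continuous_exp_neg_mul_sphereConfig (Λ := Λ) hS.continuous s₀
  have hcK : Continuous fun ω : Λ → sphere (0 : E) 1 => H (Ψ s₀ (fun m => (ω m : E))) :=
    (hK s₀).continuous.comp continuous_sphereConfig
  have hcD : Continuous fun ω : Λ → sphere (0 : E) 1 =>
      fderiv ℝ (fun z => H (Ψ s₀ z)) (fun m => (ω m : E))
        (fun n => siteGrad n (Gs s₀) (fun m => (ω m : E))) :=
    hD.comp (Continuous.prodMk_right s₀)
  have hiA : Integrable (fun ω : Λ → sphere (0 : E) 1 =>
      -(S (fun m => (ω m : E)) * Real.exp (-(s₀ * S (fun m => (ω m : E))))) *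
        H (Ψ s₀ (fun m => (ω m : E)))) (Measure.pi fun _ : Λ => uniformSphere (volume : Measure E)) :=
    integrable_pi_of_continuous _ ((hSc.mul hcW).neg.mul hcK)
  have hiB : Integrable (fun ω : Λ → sphere (0 : E) 1 =>
      Real.exp (-(s₀ * S (fun m => (ω m : E)))) *
        fderiv ℝ (fun z => H (Ψ s₀ z)) (fun m => (ω m : E))
          (fun n => siteGrad n (Gs s₀) (fun m => (ω m : E))))
      (Measure.pi fun _ : Λ => uniformSphere (volume : Measure E)) :=
    integrable_pi_of_continuous _ (hcW.mul hcD)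
  have hiC : Integrable (fun ω : Λ → sphere (0 : E) 1 =>
      Real.exp (-(s₀ * S (fun m => (ω m : E)))) * H (Ψ s₀ (fun m => (ω m : E))) *
        sphereLuscherL S s₀ (Gs s₀) (fun m => (ω m : E)))
      (Measure.pi fun _ : Λ => uniformSphere (volume : Measure E)) :=
    integrable_pi_of_continuous _ ((hcW.mul hcK).mul
      (continuous_sphereLuscherL_sphereConfig hS (hGs s₀) s₀))
  rw [integral_add hiA hiB, integral_exp_mul_fderiv_apply_siteGrad hS (hK s₀) (hGs s₀) s₀,
    ← integral_add hiA hiC]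
  refine integral_congr_ae (ae_of_all _ fun ω => ?_)
  ring

variable {G : (Λ → E) → ℝ}

/-- **THE TRANSPORT IDENTITY FOR THE SPHERE GRADIENT FLOW.**  For `S ∈ C¹`, `G ∈ C²` with flow
`Φ` (`ẋ_n = −∂̃_nG(x)` on `Ω`), `H ∈ C¹` and all real `c`, `s₀`:
`(d/ds)|_{s₀} ∫ e^{−sS(ω)} H(Φ_{c−s}ω) dπ̄(ω) = ∫ e^{−s₀S}·(H∘Φ_{c−s₀})·(𝓛_{s₀}G − S) dπ̄`. -/
theorem hasDerivAt_integral_exp_mul_comp_sphereGradientFlow {S H : (Λ → E) → ℝ}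
    (hS : ContDiff ℝ 1 S) (hG : ContDiff ℝ 2 G) (hH : ContDiff ℝ 1 H) (c s₀ : ℝ) :
    HasDerivAt (fun s => ∫ ω, Real.exp (-(s * S (fun m => ((ω : Λ → sphere (0 : E) 1) m : E)))) *
        H (sphereGradientFlow hG (fun m => (ω m : E)) (c - s))
          ∂Measure.pi (fun _ : Λ => uniformSphere (volume : Measure E)))
      (∫ ω, Real.exp (-(s₀ * S (fun m => ((ω : Λ → sphere (0 : E) 1) m : E)))) *
          H (sphereGradientFlow hG (fun m => (ω m : E)) (c - s₀)) *
            (sphereLuscherL S s₀ G (fun m => (ω m : E)) - S (fun m => (ω m : E)))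
        ∂Measure.pi (fun _ : Λ => uniformSphere (volume : Measure E))) s₀ :=
  hasDerivAt_integral_exp_mul_comp_family (Ψ := fun s z => sphereGradientFlow hG z (c - s))
    (Gs := fun _ => G) hS hH
    ((contDiff_sphereGradientFlow hG).comp (contDiff_snd.prodMk (contDiff_const.sub contDiff_fst)))
    (fun _ => hG) (fun n => (continuous_siteGrad_sphereConfig (hG.of_le (by norm_num)) n).comp
      continuous_snd)
    (fun s ω => hasDerivAt_comp_sphereGradientFlow_sub hG (hH.differentiable one_ne_zero)
      (norm_sphereConfig_eq_one ω) c s) s₀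

end Transport

end Summit.Ventures.LatticeQCDFlow.Exactness

end
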